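import Literature.InformationTheory.StateDiscrimination.RLDFisherInformation
import HarnessLib

/-!
# Classical–quantum families `ρ_θ = ⊕_x p_θ(x)ρ^x_θ`: the SLD Fisher matrix and the RLD Fisher information
# decompose as `I_F(p_θ) + Σ_x p_θ(x)·I_F(ρ^x_θ)` (Katariya–Wilde 2021 § 5.2.4 Proposition 7; two-block form)

Hodge foundations lane (`lit-hodgefound`, prover p24 gen 80; quantum-information series).  THEOREMS ONLY: no
definition, no named fact, net debt 0.  A classical–quantum state `Σ_x p(x)|x⟩⟨x| ⊗ ρ^x` over a two-letter
register is the block-diagonal matrix `fromBlocks (p₁ρ₁) 0 0 (p₂ρ₂)`; its derivative data along parameter `a`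
are `fromBlocks (ṗ₁ρ₁ + p₁∂_aρ₁) 0 0 (ṗ₂ρ₂ + p₂∂_aρ₂)` (product rule, spelled out; `ṗ_x = dp_x a`).  Vocabulary
of g80-#1/#6: SLDs `Sρ + ρS = ∂ρ` (BF normalisation), QFIM `F_ab = 2Re Tr(S_a∂_bρ)`, RLD expression
`Tr(∂_aρ ρ⁻¹ ∂_bρ)`; the classical Fisher matrix of the two-point law is `ṗ₁(a)ṗ₁(b)/p₁ + ṗ₂(a)ṗ₂(b)/p₂`.
The parameter-INDEPENDENT-weight case is g80-#1 `QFIM.qfim_fromBlocks_smul`; `n` letters follow by iterating.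

## Source, VERBATIM

V. Katariya, M. M. Wilde, *Geometric distinguishability measures limit quantum channel estimation and
discrimination*, Quantum Inf. Process. 20 (2021) 78 [KatariyaWilde2021], held `paper:arxiv-2004.10708`, § 5.2.4
(p0015): «**Proposition 7** Let `{ρ^θ_XB}_θ` be a differentiable family of classical–quantum states, where
`ρ^θ_XB := Σ_x p_θ(x)|x⟩⟨x|_X ⊗ ρ^x_θ`. Then the following decompositions hold for the SLD and RLD Fisher
informations: `I_F(θ;{ρ^θ_XB}_θ) = I_F(θ;{p_θ}_θ) + Σ_x p_θ(x)I_F(θ;{ρ^x_θ}_θ)`,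
`Î_F(θ;{ρ^θ_XB}_θ) = I_F(θ;{p_θ}_θ) + Σ_x p_θ(x)Î_F(θ;{ρ^x_θ}_θ)`. Proof. See Appendix (app:decomp-fisher-cqq).»

## What is formalized (all PROVED; two letters, the SLD line as a MATRIX identity over parameters `a, b`)

* `trace_fromBlocks_diag` (trace of a block-diagonal matrix), `sld_block` / `sld_cq` (the SLD `(ṗ_x/2p_x)𝟙 + S_x`
  on block `x`), `two_mul_trace_block` (one block: `2Tr[(c𝟙 + S)(ṗρ + p∂ρ)] = ṗ_aṗ_b/p + p·2Tr(S∂ρ)`),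
  **`qfim_cq`** (Prop. 7, SLD line: `F_ab = Σ_x ṗ_x(a)ṗ_x(b)/p_x + Σ_x p_x F^x_ab`, for ANY SLDs of the cq family),
  `inv_cq` (`(⊕ p_xρ_x)⁻¹ = ⊕ p_x⁻¹ρ_x⁻¹`), `trace_block_rld` (one block), **`rldFisher_cq`** (Prop. 7, RLD line).

NOT formalized: registers with more than two letters (iterate), rank-deficient blocks, channels.  Tree search
(FAIL-DUP, 2026-09-01): g80-#1 `qfim_fromBlocks_smul` (constant weights only); `rg "classical.quantum" Literature/InformationTheory` → docstrings only.
-/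

noncomputable section

open Matrix Finset
open scoped ComplexOrder ComplexConjugate

namespace Literature.InformationTheory.StateDiscrimination.CQDecomposition

open Literature.InformationTheory.StateDiscrimination.QFIM (trace_sld_mul_deriv_eq_of_sld_eq trace_mul_sld_eq_zero)

variable {m k ι : Type*} [Fintype m] [DecidableEq m] [Fintype k] [DecidableEq k]

omit [DecidableEq m] [DecidableEq k] in
/-- `Tr(A ⊕ D) = Tr A + Tr D`. [folklore] -/
private theorem trace_fromBlocks_diag (A : Matrix m m ℂ) (B : Matrix m k ℂ) (C : Matrix k m ℂ) (D : Matrix k k ℂ) :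
    (fromBlocks A B C D).trace = A.trace + D.trace := by
  simp [Matrix.trace, Fintype.sum_sum_type]

omit [DecidableEq m] [DecidableEq k] in
/-- Product of block-diagonal matrices. [folklore] -/
private theorem fromBlocks_diag_mul (A A' : Matrix m m ℂ) (D D' : Matrix k k ℂ) :
    fromBlocks A 0 0 D * fromBlocks A' 0 0 D' = fromBlocks (A * A') 0 0 (D * D') := by
  rw [fromBlocks_multiply]
  simp

/-! ## The SLD line -/

/-- **One block of the cq SLD**: if `Sρ + ρS = ∂ρ` and `p ≠ 0`, then `(ṗ/2p)𝟙 + S` solves the SLD equation for the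
block `pρ` with derivative `ṗρ + p∂ρ`. [cite: KatariyaWilde2021, §5.2.4 Prop. 7 (proof, Appendix)] -/
theorem sld_block {n : Type*} [Fintype n] [DecidableEq n] {ρ S D : Matrix n n ℂ} (hSD : S * ρ + ρ * S = D)
    {p : ℝ} (hp : p ≠ 0) (dp : ℝ) :
    (((dp : ℂ) / (2 * p)) • (1 : Matrix n n ℂ) + S) * ((p : ℂ) • ρ) +
        ((p : ℂ) • ρ) * (((dp : ℂ) / (2 * p)) • (1 : Matrix n n ℂ) + S) = (dp : ℂ) • ρ + (p : ℂ) • D := by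
  have hp' : (p : ℂ) ≠ 0 := by exact_mod_cast hp
  rw [← hSD]
  simp only [Matrix.add_mul, Matrix.mul_add, Matrix.smul_mul, Matrix.mul_smul, Matrix.one_mul, Matrix.mul_one,
    smul_smul, smul_add]
  rw [show (dp : ℂ) / (2 * p) * p = dp / 2 by field_simp, show (p : ℂ) * ((dp : ℂ) / (2 * p)) = dp / 2 by field_simp]
  module

/-- **The cq SLD** `⊕_x [(ṗ_x/2p_x)𝟙 + S_x]` solves the SLD equation of `⊕_x p_xρ_x` with derivative
`⊕_x (ṗ_xρ_x + p_x∂ρ_x)`. [cite: KatariyaWilde2021, §5.2.4 Prop. 7] -/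
theorem sld_cq {ρ₁ S₁ D₁ : Matrix m m ℂ} {ρ₂ S₂ D₂ : Matrix k k ℂ} (h₁ : S₁ * ρ₁ + ρ₁ * S₁ = D₁)
    (h₂ : S₂ * ρ₂ + ρ₂ * S₂ = D₂) {p₁ p₂ : ℝ} (hp₁ : p₁ ≠ 0) (hp₂ : p₂ ≠ 0) (dp₁ dp₂ : ℝ) :
    fromBlocks (((dp₁ : ℂ) / (2 * p₁)) • (1 : Matrix m m ℂ) + S₁) 0 0 (((dp₂ : ℂ) / (2 * p₂)) • (1 : Matrix k k ℂ) + S₂) *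
        fromBlocks ((p₁ : ℂ) • ρ₁) 0 0 ((p₂ : ℂ) • ρ₂) +
      fromBlocks ((p₁ : ℂ) • ρ₁) 0 0 ((p₂ : ℂ) • ρ₂) *
        fromBlocks (((dp₁ : ℂ) / (2 * p₁)) • (1 : Matrix m m ℂ) + S₁) 0 0 (((dp₂ : ℂ) / (2 * p₂)) • (1 : Matrix k k ℂ) + S₂) =
      fromBlocks ((dp₁ : ℂ) • ρ₁ + (p₁ : ℂ) • D₁) 0 0 ((dp₂ : ℂ) • ρ₂ + (p₂ : ℂ) • D₂) := by
  rw [fromBlocks_diag_mul, fromBlocks_diag_mul, fromBlocks_add, add_zero, add_zero, sld_block h₁ hp₁, sld_block h₂ hp₂]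

/-- **One block of the trace**: `2Tr[((ṗ_a/2p)𝟙 + S_a)(ṗ_bρ + p∂_bρ)] = ṗ_aṗ_b/p + p·2Tr(S_a∂_bρ)` for `Tr ρ = 1`,
`Tr ∂_bρ = 0`, `Tr(ρS_a) = 0`. [cite: KatariyaWilde2021, §5.2.4 Prop. 7 (proof)] -/
theorem two_mul_trace_block {n : Type*} [Fintype n] [DecidableEq n] {ρ Sa Db : Matrix n n ℂ} (hρ1 : ρ.trace = 1)
    (hDb : Db.trace = 0) (hSa : (ρ * Sa).trace = 0) {p : ℝ} (hp : p ≠ 0) (dpa dpb : ℝ) :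
    2 * ((((dpa : ℂ) / (2 * p)) • (1 : Matrix n n ℂ) + Sa) * ((dpb : ℂ) • ρ + (p : ℂ) • Db)).trace =
      (dpa : ℂ) * dpb / p + p * (2 * (Sa * Db).trace) := by
  have hp' : (p : ℂ) ≠ 0 := by exact_mod_cast hp
  simp only [Matrix.add_mul, Matrix.mul_add, Matrix.smul_mul, Matrix.mul_smul, Matrix.one_mul, trace_add,
    trace_smul, smul_eq_mul, hρ1, hDb, Matrix.trace_mul_comm Sa ρ, hSa]
  field_simp
  ring

/-- Real part bookkeeping for the block identity. [folklore] -/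
private theorem re_block (dpa dpb p : ℝ) (z : ℂ) :
    ((dpa : ℂ) * dpb / p + p * (2 * z)).re = dpa * dpb / p + p * (2 * z.re) := by
  have h1 : ((dpa : ℂ) * dpb / p) = ((dpa * dpb / p : ℝ) : ℂ) := by push_cast; ring
  rw [Complex.add_re, h1, Complex.ofReal_re, Complex.re_ofReal_mul]
  simp

/-- **Proposition 7, SLD line (matrix form, two letters)**: for the classical–quantum family
`ρ = p₁ρ₁ ⊕ p₂ρ₂` with derivative data `∂_aρ = (ṗ₁(a)ρ₁ + p₁∂_aρ₁) ⊕ (ṗ₂(a)ρ₂ + p₂∂_aρ₂)` (`Tr ρ_x = 1`,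
`Tr ∂_bρ_x = 0`, `p_x ≠ 0`, SLDs `S_x` on the blocks with QFIMs `F_x`), and ANY SLDs `S_a` of the cq family:
`F_ab = [ṗ₁(a)ṗ₁(b)/p₁ + ṗ₂(a)ṗ₂(b)/p₂] + p₁F₁_ab + p₂F₂_ab` — the classical Fisher matrix of `p_θ` plus the
average of the quantum ones. [cite: KatariyaWilde2021, §5.2.4 Prop. 7 (SLD line)] -/
theorem qfim_cq [Fintype ι] {ρ₁ : Matrix m m ℂ} {ρ₂ : Matrix k k ℂ} (hρ₁1 : ρ₁.trace = 1) (hρ₂1 : ρ₂.trace = 1)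
    {S₁ D₁ : ι → Matrix m m ℂ} {S₂ D₂ : ι → Matrix k k ℂ} (hSD₁ : ∀ a, S₁ a * ρ₁ + ρ₁ * S₁ a = D₁ a)
    (hSD₂ : ∀ a, S₂ a * ρ₂ + ρ₂ * S₂ a = D₂ a) (hD₁ : ∀ a, (D₁ a).trace = 0) (hD₂ : ∀ a, (D₂ a).trace = 0)
    {p₁ p₂ : ℝ} (hp₁ : p₁ ≠ 0) (hp₂ : p₂ ≠ 0) (dp₁ dp₂ : ι → ℝ) {S : ι → Matrix (m ⊕ k) (m ⊕ k) ℂ}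
    (hSD : ∀ a, S a * fromBlocks ((p₁ : ℂ) • ρ₁) 0 0 ((p₂ : ℂ) • ρ₂) +
      fromBlocks ((p₁ : ℂ) • ρ₁) 0 0 ((p₂ : ℂ) • ρ₂) * S a =
      fromBlocks ((dp₁ a : ℂ) • ρ₁ + (p₁ : ℂ) • D₁ a) 0 0 ((dp₂ a : ℂ) • ρ₂ + (p₂ : ℂ) • D₂ a))
    {F₁ F₂ F : Matrix ι ι ℝ} (hF₁ : ∀ a b, F₁ a b = 2 * (S₁ a * D₁ b).trace.re)
    (hF₂ : ∀ a b, F₂ a b = 2 * (S₂ a * D₂ b).trace.re)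
    (hF : ∀ a b, F a b = 2 * (S a * fromBlocks ((dp₁ b : ℂ) • ρ₁ + (p₁ : ℂ) • D₁ b) 0 0
      ((dp₂ b : ℂ) • ρ₂ + (p₂ : ℂ) • D₂ b)).trace.re) (a b : ι) :
    F a b = (dp₁ a * dp₁ b / p₁ + dp₂ a * dp₂ b / p₂) + p₁ * F₁ a b + p₂ * F₂ a b := by
  have h2 : ∀ z : ℂ, 2 * z.re = (2 * z).re := fun z => by simp
  rw [hF, h2, trace_sld_mul_deriv_eq_of_sld_eq _ (hSD a) (sld_cq (hSD₁ a) (hSD₂ a) hp₁ hp₂ (dp₁ a) (dp₂ a)) (hSD b),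
    fromBlocks_diag_mul, trace_fromBlocks_diag, mul_add, two_mul_trace_block hρ₁1 (hD₁ b) (trace_mul_sld_eq_zero (hSD₁ a) (hD₁ a)) hp₁,
    two_mul_trace_block hρ₂1 (hD₂ b) (trace_mul_sld_eq_zero (hSD₂ a) (hD₂ a)) hp₂, Complex.add_re, re_block,
    re_block, hF₁, hF₂]
  ring

/-! ## The RLD line -/

/-- `(p₁ρ₁ ⊕ p₂ρ₂)⁻¹ = p₁⁻¹ρ₁⁻¹ ⊕ p₂⁻¹ρ₂⁻¹` for full-rank blocks and nonzero weights. [cite: KatariyaWilde2021, §5.2.4 Prop. 7 (RLD line)] -/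
theorem inv_cq {ρ₁ : Matrix m m ℂ} {ρ₂ : Matrix k k ℂ} (hρ₁ : ρ₁.PosDef) (hρ₂ : ρ₂.PosDef) {p₁ p₂ : ℝ}
    (hp₁ : p₁ ≠ 0) (hp₂ : p₂ ≠ 0) :
    (fromBlocks ((p₁ : ℂ) • ρ₁) 0 0 ((p₂ : ℂ) • ρ₂))⁻¹ =
      fromBlocks (((p₁ : ℂ))⁻¹ • ρ₁⁻¹) 0 0 (((p₂ : ℂ))⁻¹ • ρ₂⁻¹) := by
  refine Matrix.inv_eq_left_inv ?_
  have hu₁ : IsUnit ρ₁.det := (isUnit_iff_isUnit_det _).mp hρ₁.isUnit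
  have hu₂ : IsUnit ρ₂.det := (isUnit_iff_isUnit_det _).mp hρ₂.isUnit
  have hp₁' : (p₁ : ℂ) ≠ 0 := by exact_mod_cast hp₁
  have hp₂' : (p₂ : ℂ) ≠ 0 := by exact_mod_cast hp₂
  rw [fromBlocks_diag_mul, Matrix.smul_mul, Matrix.mul_smul, smul_smul, Matrix.smul_mul, Matrix.mul_smul, smul_smul,
    nonsing_inv_mul _ hu₁, nonsing_inv_mul _ hu₂, inv_mul_cancel₀ hp₁', inv_mul_cancel₀ hp₂', one_smul, one_smul,
    fromBlocks_one]

/-- **One block of the RLD trace**: `Tr[(ṗ_aρ + p∂_aρ)(pρ)⁻¹(ṗ_bρ + p∂_bρ)] = ṗ_aṗ_b/p + p·Tr(∂_aρρ⁻¹∂_bρ)` for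
`ρ ≻ 0`, `Tr ρ = 1`, `Tr ∂ρ = 0`, `p ≠ 0`. [cite: KatariyaWilde2021, §5.2.4 Prop. 7 (RLD line, proof)] -/
theorem trace_block_rld {n : Type*} [Fintype n] [DecidableEq n] {ρ Da Db : Matrix n n ℂ} (hρ : ρ.PosDef)
    (hρ1 : ρ.trace = 1) (hDa : Da.trace = 0) (hDb : Db.trace = 0) {p : ℝ} (hp : p ≠ 0) (dpa dpb : ℝ) :
    (((dpa : ℂ) • ρ + (p : ℂ) • Da) * (((p : ℂ))⁻¹ • ρ⁻¹) * ((dpb : ℂ) • ρ + (p : ℂ) • Db)).trace =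
      (dpa : ℂ) * dpb / p + (p : ℂ) * (Da * ρ⁻¹ * Db).trace := by
  have hu : IsUnit ρ.det := (isUnit_iff_isUnit_det _).mp hρ.isUnit
  have hp' : (p : ℂ) ≠ 0 := by exact_mod_cast hp
  have e1 : (ρ * ρ⁻¹ * Db).trace = 0 := by rw [mul_nonsing_inv _ hu, Matrix.one_mul, hDb]
  have e2 : (Da * ρ⁻¹ * ρ).trace = 0 := by rw [nonsing_inv_mul_cancel_right _ _ hu, hDa]
  have e3 : (ρ * ρ⁻¹ * ρ).trace = 1 := by rw [mul_nonsing_inv _ hu, Matrix.one_mul, hρ1]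
  rw [Matrix.add_mul, Matrix.add_mul, Matrix.mul_add, Matrix.mul_add]
  simp only [Matrix.smul_mul, Matrix.mul_smul, smul_smul, trace_add, trace_smul, smul_eq_mul, e1, e2, e3]
  field_simp
  ring

/-- **Proposition 7, RLD line (two letters)**: for full-rank blocks `ρ_x ≻ 0` with `Tr ρ_x = 1`, trace-free
derivatives and `p_x ≠ 0`: `Tr(∂_aρ ρ⁻¹ ∂_bρ) = [ṗ₁(a)ṗ₁(b)/p₁ + ṗ₂(a)ṗ₂(b)/p₂] + p₁Tr(∂_aρ₁ρ₁⁻¹∂_bρ₁) + p₂Tr(∂_aρ₂ρ₂⁻¹∂_bρ₂)`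
— the classical Fisher information of `p_θ` plus the average RLD Fisher information. [cite: KatariyaWilde2021, §5.2.4 Prop. 7 (RLD line)] -/
theorem rldFisher_cq {ρ₁ Da₁ Db₁ : Matrix m m ℂ} {ρ₂ Da₂ Db₂ : Matrix k k ℂ} (hρ₁ : ρ₁.PosDef) (hρ₂ : ρ₂.PosDef)
    (hρ₁1 : ρ₁.trace = 1) (hρ₂1 : ρ₂.trace = 1) (hDa₁ : Da₁.trace = 0) (hDb₁ : Db₁.trace = 0)
    (hDa₂ : Da₂.trace = 0) (hDb₂ : Db₂.trace = 0) {p₁ p₂ : ℝ} (hp₁ : p₁ ≠ 0) (hp₂ : p₂ ≠ 0)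
    (dpa₁ dpb₁ dpa₂ dpb₂ : ℝ) :
    (fromBlocks ((dpa₁ : ℂ) • ρ₁ + (p₁ : ℂ) • Da₁) 0 0 ((dpa₂ : ℂ) • ρ₂ + (p₂ : ℂ) • Da₂) *
        (fromBlocks ((p₁ : ℂ) • ρ₁) 0 0 ((p₂ : ℂ) • ρ₂))⁻¹ *
        fromBlocks ((dpb₁ : ℂ) • ρ₁ + (p₁ : ℂ) • Db₁) 0 0 ((dpb₂ : ℂ) • ρ₂ + (p₂ : ℂ) • Db₂)).trace =
      ((dpa₁ : ℂ) * dpb₁ / p₁ + (dpa₂ : ℂ) * dpb₂ / p₂) + (p₁ : ℂ) * (Da₁ * ρ₁⁻¹ * Db₁).trace +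
        (p₂ : ℂ) * (Da₂ * ρ₂⁻¹ * Db₂).trace := by
  rw [inv_cq hρ₁ hρ₂ hp₁ hp₂, fromBlocks_diag_mul, fromBlocks_diag_mul, trace_fromBlocks_diag,
    trace_block_rld hρ₁ hρ₁1 hDa₁ hDb₁ hp₁, trace_block_rld hρ₂ hρ₂1 hDa₂ hDb₂ hp₂]
  ring

end Literature.InformationTheory.StateDiscrimination.CQDecomposition

end
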